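import Summits.Schanuel.Schanuel.Theorems.RootDecomp1KNW96Core01

/-!
# RootDecomp1KNW96Core — lens 6, generation 23 «NW96 CORE» (PROGRAMME G23-a of VERDICT L2098, CHECKLIST L2131; THEOREM lane, FACT-FREE): the GENERAL core of Nesterenko–Waldschmidt 1996 §6 a)–d) — conclusion False from an explicit displayed main inequality with ALL parameters free, over F : IntermediateField ℚ ℂ finite over ℚ, θ ∈ ℂ arbitrary, α β ∈ F non-zero of ANY height, TWO-SIDED perturbation ‖e^θ − α‖ + ‖θ − β‖, the HONEST signed column range |s| ≤ S₁ (the g22 audit's finding) and a SHARP two-variable Liouville step charging (D − 1) — continuation (RootDecomp1KNW96Core02): §2 general-θ entries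

(lens-6 g23 HOME kernel NW96Core.lean 19b22368…, 953 l, imports Literature ExpAlgebraicTranscendenceMeasureCore + PiTranscendenceMeasureCore (tree-only); CLAIM L2129, ACK/CHECKLIST G23-a L2131, NODE L2136 / REQUEST L2137, critic VERDICT L2143 (crit g9: CLEARED — THEOREM ×1 (G23-a); lens-6 tally THEOREM ×5 + CELL ×3 + AUDIT ×1; PORT GO in substance Summit-side now `--supports stmt-Schanuel-33364`, the scoped `maxHeartbeats 2000000` flagged for the port record; Literature-side relocation = one ticket with G23-b later); port by census-1 gen 18 as `RootDecomp1KNW96Core01`–`03`: 01 = §1 the sharp local–global / two-variable Liouville inequality (length charged with D − 1) in the Height.AdmissibleAbsValues framework; 02 = §2 general-θ entries (derivatives of Fel'dman's Δ-basis × e^{θtz}, the two-sided perturbation, the scaled integer form); 03 = §3 THE CORE THEOREM `core` (one ≈ 380-line proof, steps a)–d), scoped `maxHeartbeats 2000000` carried as in K).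
PORT EDITS: `set_option linter.dupNamespace false` and the unused `import HarnessLib` dropped; statements and proofs verbatim (0 undocumented decls in K). `--supports stmt-Schanuel-33364`; no census credit carried; rung 0 — nothing here proves Schanuel, and nothing here asserts any constant for NW96 Thm 1.)
-/

noncomputable section

open Finset

namespace Summit.Schanuel.Schanuel.Theorems.RootDecomp1KNW96Core

open Literature.NumberTheory.Transcendental

/-! ## §2  General-`θ` entries: derivatives, the two-sided perturbation, the scaled integer form -/

section Entries

open Polynomial NWPi FeldmanDelta NW1996 Waldschmidt1978 Complex
open scoped Nat

/-- `‖x^(n+1) − y^(n+1)‖ ≤ (n+1) B^n ‖x − y‖` for `‖x‖, ‖y‖ ≤ B`. [folklore] -/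
theorem norm_pow_succ_sub_pow_succ_le {x y : ℂ} {B : ℝ} (hx : ‖x‖ ≤ B) (hy : ‖y‖ ≤ B) (n : ℕ) :
    ‖x ^ (n + 1) - y ^ (n + 1)‖ ≤ (n + 1 : ℝ) * B ^ n * ‖x - y‖ := by
  have hB : 0 ≤ B := (norm_nonneg x).trans hx
  induction n with
  | zero => simp
  | succ n ih =>
    have h : x ^ (n + 2) - y ^ (n + 2) = x * (x ^ (n + 1) - y ^ (n + 1)) + (x - y) * y ^ (n + 1) := by ring
    rw [h]
    refine (norm_add_le _ _).trans ?_
    rw [norm_mul, norm_mul, norm_pow]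
    have h1 : ‖x‖ * ‖x ^ (n + 1) - y ^ (n + 1)‖ ≤ B * ((n + 1 : ℝ) * B ^ n * ‖x - y‖) :=
      mul_le_mul hx ih (norm_nonneg _) hB
    have h2 : ‖x - y‖ * ‖y‖ ^ (n + 1) ≤ ‖x - y‖ * B ^ (n + 1) :=
      mul_le_mul_of_nonneg_left (pow_le_pow_left₀ (norm_nonneg _) hy _) (norm_nonneg _)
    calc ‖x‖ * ‖x ^ (n + 1) - y ^ (n + 1)‖ + ‖x - y‖ * ‖y‖ ^ (n + 1)
        ≤ B * ((n + 1 : ℝ) * B ^ n * ‖x - y‖) + ‖x - y‖ * B ^ (n + 1) := add_le_add h1 h2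
      _ = ((n + 1 : ℕ) + 1 : ℝ) * B ^ (n + 1) * ‖x - y‖ := by push_cast; ring

/-- **The perturbation of a Laurent monomial** ([NesterenkoWaldschmidt1996, §6 b)], the factor
`e^{(|ℓ|+1)|θ|}`): if `‖a‖, ‖b‖, ‖a‖⁻¹, ‖b‖⁻¹ ≤ B` (`B ≥ 1`, `a, b ≠ 0`) then
`‖a^j − b^j‖ ≤ N B^{N+1} ‖a − b‖` for every integer `|j| ≤ N` (for `j < 0` via
`a^{-n} − b^{-n} = (a⁻¹ − b⁻¹) ∑ a^{-i} b^{-(n-1-i)}` and `‖a⁻¹ − b⁻¹‖ ≤ B² ‖a − b‖`; the tree's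
`Waldschmidt1978.norm_zpow_sub_zpow_le'` has the cruder `B^{3N}`). [cite: NesterenkoWaldschmidt1996, §6 b)] -/
theorem norm_zpow_sub_zpow_le_sharp {a b : ℂ} {B : ℝ} (hB : 1 ≤ B) (ha : ‖a‖ ≤ B) (hb : ‖b‖ ≤ B)
    (ha0 : a ≠ 0) (hb0 : b ≠ 0) (ha' : ‖a‖⁻¹ ≤ B) (hb' : ‖b‖⁻¹ ≤ B) {N : ℕ} {j : ℤ}
    (hj : |j| ≤ N) :
    ‖a ^ j - b ^ j‖ ≤ N * B ^ (N + 1) * ‖a - b‖ := by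
  have hB0 : 0 ≤ B := zero_le_one.trans hB
  have hδ0 : 0 ≤ ‖a - b‖ := norm_nonneg _
  rcases Int.natAbs_eq j with h | h
  · -- `j = n ≥ 0`
    set n := j.natAbs with hn
    have hnN : n ≤ N := by
      have : (n : ℤ) = |j| := (Int.natCast_natAbs j)
      exact_mod_cast this.trans_le hj
    rw [h, zpow_natCast, zpow_natCast]
    rcases Nat.eq_zero_or_pos n with hn0 | hnpos
    · rw [hn0, pow_zero, pow_zero, sub_self, norm_zero]; positivity
    · obtain ⟨k, hk⟩ : ∃ k, n = k + 1 := ⟨n - 1, by omega⟩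
      rw [hk]
      refine (norm_pow_succ_sub_pow_succ_le ha hb k).trans ?_
      have h1 : (k + 1 : ℝ) ≤ N := by exact_mod_cast (hk ▸ hnN)
      have h2 : B ^ k ≤ B ^ (N + 1) := pow_le_pow_right₀ hB (by omega)
      gcongr
  · -- `j = -n`, `n ≥ 1`
    set n := j.natAbs with hn
    have hnN : n ≤ N := by
      have : (n : ℤ) = |j| := (Int.natCast_natAbs j)
      exact_mod_cast this.trans_le hj
    rw [h, zpow_neg, zpow_neg, zpow_natCast, zpow_natCast, ← inv_pow, ← inv_pow]
    rcases Nat.eq_zero_or_pos n with hn0 | hnpos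
    · rw [hn0, pow_zero, pow_zero, sub_self, norm_zero]; positivity
    · obtain ⟨k, hk⟩ : ∃ k, n = k + 1 := ⟨n - 1, by omega⟩
      rw [hk]
      have hai : ‖a⁻¹‖ ≤ B := by rwa [norm_inv]
      have hbi : ‖b⁻¹‖ ≤ B := by rwa [norm_inv]
      refine (norm_pow_succ_sub_pow_succ_le hai hbi k).trans ?_
      have hinv : ‖a⁻¹ - b⁻¹‖ ≤ B ^ 2 * ‖a - b‖ := by
        rw [inv_sub_inv ha0 hb0, norm_div, norm_mul, norm_sub_rev]
        rw [div_eq_mul_inv, mul_inv, mul_comm]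
        refine mul_le_mul_of_nonneg_right ?_ hδ0
        rw [← norm_inv, ← norm_inv, pow_two]
        exact mul_le_mul hai hbi (norm_nonneg _) hB0
      have h1 : (k + 1 : ℝ) ≤ N := by exact_mod_cast (hk ▸ hnN)
      have h2 : B ^ k * B ^ 2 ≤ B ^ (N + 1) := by
        rw [← pow_add]; exact pow_le_pow_right₀ hB (by omega)
      calc (k + 1 : ℝ) * B ^ k * ‖a⁻¹ - b⁻¹‖ ≤ (k + 1 : ℝ) * B ^ k * (B ^ 2 * ‖a - b‖) := by gcongr
        _ = (k + 1 : ℝ) * (B ^ k * B ^ 2) * ‖a - b‖ := by ring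
        _ ≤ N * B ^ (N + 1) * ‖a - b‖ := by gcongr

/-- **The derivatives on the discs, general `θ`** ([NesterenkoWaldschmidt1996, (6.2), §6 b)]):
for `σ ≤ S`, `τ ≤ T`, `H ≥ 1`, `‖c‖ ≤ K` with `K ≥ 1`, `‖c‖ ≤ K'` with `K' ≥ 0`, `0 ≤ R`, `|z| ≤ R`:
`|(d/dz)^σ (Δ_τ(z) e^{cz})| ≤ S^S e^{T+H} (1 + R/H)^T K^S e^{K'R}` (two constants: `K` for the powers
`|c|^{σ-k}`, `K'` for `|e^{cz}|`; `NWPi.norm_iteratedDeriv_f_le` is the case `K' = K`).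
[cite: NesterenkoWaldschmidt1996, §6 (6.5)] -/
theorem norm_iteratedDeriv_f_le' {τ H σ S T : ℕ} (hH : 1 ≤ H) (hσ : σ ≤ S) (hτ : τ ≤ T) {c : ℂ}
    {K K' R : ℝ} (hK : 1 ≤ K) (hcK : ‖c‖ ≤ K) (hK' : 0 ≤ K') (hcK' : ‖c‖ ≤ K') (hR : 0 ≤ R)
    {z : ℂ} (hz : ‖z‖ ≤ R) :
    ‖iteratedDeriv σ (fun w : ℂ => (delta τ H).eval w * cexp (c * w)) z‖ ≤
      (S : ℝ) ^ S * Real.exp ((T : ℝ) + H) * (1 + R / H) ^ T * K ^ S * Real.exp (K' * R) := by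
  have hH0 : (0 : ℝ) < H := by exact_mod_cast hH
  have hden0 : (0 : ℝ) < den τ H := by exact_mod_cast den_pos τ H
  rw [iteratedDeriv_f]
  refine (norm_sum_le _ _).trans ?_
  have hexp : ‖cexp (c * z)‖ ≤ Real.exp (K' * R) := by
    refine (Complex.norm_exp_le_exp_norm _).trans ?_
    rw [Real.exp_le_exp, norm_mul]
    exact mul_le_mul hcK' hz (norm_nonneg _) hK'
  have hterm : ∀ k ∈ range (σ + 1),
      ‖(σ.choose k : ℂ) * (((den τ H : ℂ))⁻¹ * ((k ! : ℂ) * (hasseDeriv k (num ℂ τ H)).eval z)) *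
          (c ^ (σ - k) * cexp (c * z))‖ ≤
        ((den τ H : ℝ))⁻¹ * (K ^ σ * Real.exp (K' * R)) *
          ((σ.choose k : ℝ) * k ! * ‖(hasseDeriv k (num ℂ τ H)).eval z‖) := by
    intro k _
    rw [norm_mul, norm_mul, norm_mul, norm_mul, norm_mul, norm_inv, norm_pow, Complex.norm_natCast,
      Complex.norm_natCast, Complex.norm_natCast]
    have h1 : ‖c‖ ^ (σ - k) ≤ K ^ σ :=
      (pow_le_pow_left₀ (norm_nonneg _) hcK _).trans (pow_le_pow_right₀ hK (Nat.sub_le _ _))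
    calc (σ.choose k : ℝ) * (((den τ H : ℝ))⁻¹ * ((k ! : ℝ) * ‖(hasseDeriv k (num ℂ τ H)).eval z‖)) *
          (‖c‖ ^ (σ - k) * ‖cexp (c * z)‖)
        ≤ (σ.choose k : ℝ) * (((den τ H : ℝ))⁻¹ * ((k ! : ℝ) * ‖(hasseDeriv k (num ℂ τ H)).eval z‖)) *
          (K ^ σ * Real.exp (K' * R)) := by
          refine mul_le_mul_of_nonneg_left ?_ (by positivity)
          exact mul_le_mul h1 hexp (norm_nonneg _) (by positivity)
      _ = _ := by ring
  refine (Finset.sum_le_sum hterm).trans ?_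
  rw [← Finset.mul_sum]
  have h43 := sum_choose_mul_factorial_mul_norm_hasse_le τ σ hH z
  have hbase : 1 + ‖z‖ / H ≤ 1 + R / H := by gcongr
  have hbase1 : (1 : ℝ) ≤ 1 + R / H := by
    have : (0 : ℝ) ≤ R / H := by positivity
    linarith
  have hpowτ : (1 + ‖z‖ / H) ^ τ ≤ (1 + R / H) ^ T :=
    (pow_le_pow_left₀ (by positivity) hbase τ).trans (pow_le_pow_right₀ hbase1 hτ)
  have hexpτ : Real.exp ((τ : ℝ) + H) ≤ Real.exp ((T : ℝ) + H) := by
    rw [Real.exp_le_exp]; gcongr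
  have hσS := pow_self_le_pow_self hσ
  have hKσ : K ^ σ ≤ K ^ S := pow_le_pow_right₀ hK hσ
  calc ((den τ H : ℝ))⁻¹ * (K ^ σ * Real.exp (K' * R)) *
        ∑ k ∈ range (σ + 1), (σ.choose k : ℝ) * k ! * ‖(hasseDeriv k (num ℂ τ H)).eval z‖
      ≤ ((den τ H : ℝ))⁻¹ * (K ^ σ * Real.exp (K' * R)) *
        ((σ : ℝ) ^ σ * Real.exp ((τ : ℝ) + H) * (1 + ‖z‖ / H) ^ τ * den τ H) :=
        mul_le_mul_of_nonneg_left h43 (by positivity)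
    _ = (σ : ℝ) ^ σ * Real.exp ((τ : ℝ) + H) * (1 + ‖z‖ / H) ^ τ * K ^ σ * Real.exp (K' * R) := by
        field_simp
    _ ≤ _ := by gcongr

/-- At an integer point `s`, for an integer `t`: `f_{τ,t}^{(σ)}(s) =
den_τ⁻¹ (∑ₖ C(σ,k) k! A(τ,k,s) (θt)^{σ-k}) · (e^θ)^{ts}`, `f_{τ,t}(z) = Δ_τ(z) e^{θtz}`
(general `θ`; `NWPi.iteratedDeriv_f_int` is the case `θ = πi`). [cite: NesterenkoWaldschmidt1996, §6 (6.2)] -/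
theorem iteratedDeriv_f_int' (θ : ℂ) (τ H σ : ℕ) (s t : ℤ) :
    iteratedDeriv σ (fun w : ℂ => (delta τ H).eval w * cexp (θ * t * w)) (s : ℂ) =
      ((den τ H : ℂ))⁻¹ * (∑ k ∈ range (σ + 1),
        (σ.choose k : ℂ) * (k ! : ℂ) * (hasseZ τ H k s : ℂ) * (θ * t) ^ (σ - k)) *
        cexp θ ^ (t * s) := by
  rw [show (fun w : ℂ => (delta τ H).eval w * cexp (θ * t * w)) =
      fun w : ℂ => (delta τ H).eval w * cexp ((θ * t) * w) from rfl, iteratedDeriv_f]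
  have hexp : cexp (θ * t * (s : ℂ)) = cexp θ ^ (t * s) := by
    rw [← Complex.exp_int_mul θ (t * s)]; push_cast; ring_nf
  rw [Finset.mul_sum, Finset.sum_mul]
  refine Finset.sum_congr rfl fun k _ => ?_
  rw [hexp, hasseDeriv_num_eval, ← cast_hasseZ]
  ring

/-- **The two-sided perturbation, general `θ`** ([NesterenkoWaldschmidt1996, §6 b)]): the algebraic
entry `((∂ + tβ)^σ Δ_τ)(s) α^{ts}` differs from `f_{τ,t}^{(σ)}(s)` (`f_{τ,t}(z) = Δ_τ(z) e^{θtz}`) by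
at most `S^S e^{T+H} (1 + S₁/H)^T T₁^S · R^S B^{T₁S₁+1} (S |β − θ| + T₁S₁ |α − e^θ|)` when
`|β|, |θ| ≤ R` (`R ≥ 1`), `|α|^{±1}, |e^θ|^{±1} ≤ B` (`B ≥ 1`), `σ ≤ S`, `τ ≤ T`, `|s| ≤ S₁`,
`|t| ≤ T₁`, `T₁ ≥ 1` (from `β^kα^ℓ − θ^k e^{θℓ} = (β^k − θ^k)α^ℓ + θ^k(α^ℓ − e^{θℓ})`).
[cite: NesterenkoWaldschmidt1996, §6 b)] -/
theorem norm_alg_sub_analytic_le' {θ α β : ℂ} {H σ τ S T S₁ T₁ : ℕ} {s t : ℤ} {R B : ℝ}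
    (hH : 1 ≤ H) (hσ : σ ≤ S) (hτ : τ ≤ T) (hT₁ : 1 ≤ T₁) (hs : |s| ≤ S₁) (ht : |t| ≤ T₁)
    (hR : 1 ≤ R) (hβR : ‖β‖ ≤ R) (hθR : ‖θ‖ ≤ R) (hB : 1 ≤ B) (hα0 : α ≠ 0) (hαB : ‖α‖ ≤ B)
    (hαB' : ‖α‖⁻¹ ≤ B) (hwB : ‖cexp θ‖ ≤ B) (hwB' : ‖cexp θ‖⁻¹ ≤ B) :
    ‖((twist ((t : ℂ) * β) ^ σ) (delta τ H)).eval (s : ℂ) * α ^ (t * s) -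
        iteratedDeriv σ (fun w : ℂ => (delta τ H).eval w * cexp (θ * t * w)) (s : ℂ)‖ ≤
      (S : ℝ) ^ S * Real.exp ((T : ℝ) + H) * (1 + (S₁ : ℝ) / H) ^ T * (T₁ : ℝ) ^ S *
        (R ^ S * B ^ (T₁ * S₁ + 1) * ((S : ℝ) * ‖β - θ‖ + ((T₁ * S₁ : ℕ) : ℝ) * ‖α - cexp θ‖)) := by
  have hH0 : (0 : ℝ) < H := by exact_mod_cast hH
  have hden0 : (0 : ℝ) < den τ H := by exact_mod_cast den_pos τ H
  have hT₁r : (1 : ℝ) ≤ T₁ := by exact_mod_cast hT₁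
  have hR0 : 0 ≤ R := zero_le_one.trans hR
  have hB0 : 0 ≤ B := zero_le_one.trans hB
  have htr : ‖(t : ℂ)‖ ≤ T₁ := by
    rw [Complex.norm_intCast, ← Int.cast_abs]; exact_mod_cast ht
  have hsr : |(s : ℝ)| ≤ S₁ := by rw [← Int.cast_abs]; exact_mod_cast hs
  set w : ℂ := cexp θ with hw
  have hw0 : w ≠ 0 := Complex.exp_ne_zero θ
  set N : ℕ := T₁ * S₁ with hN
  have htsN : |t * s| ≤ N := by
    rw [abs_mul, hN]; push_cast
    exact mul_le_mul ht hs (abs_nonneg _) (by positivity)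
  set Pe : ℝ := R ^ S * B ^ (N + 1) * ((S : ℝ) * ‖β - θ‖ + (N : ℝ) * ‖α - w‖) with hPe
  have hPe0 : 0 ≤ Pe := by rw [hPe]; positivity
  -- the key monomial perturbation
  have hmono : ∀ k ≤ S, ‖β ^ k * α ^ (t * s) - θ ^ k * w ^ (t * s)‖ ≤ Pe := by
    intro k hk
    have e : β ^ k * α ^ (t * s) - θ ^ k * w ^ (t * s) =
        (β ^ k - θ ^ k) * α ^ (t * s) + θ ^ k * (α ^ (t * s) - w ^ (t * s)) := by ring
    rw [e]
    refine (norm_add_le _ _).trans ?_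
    rw [norm_mul, norm_mul]
    have h1 : ‖β ^ k - θ ^ k‖ ≤ (S : ℝ) * R ^ S * ‖β - θ‖ := by
      refine (norm_pow_sub_pow_le_of_le hR hβR hθR k).trans ?_
      have hkS : (k : ℝ) ≤ S := by exact_mod_cast hk
      have hRk : R ^ k ≤ R ^ S := pow_le_pow_right₀ hR hk
      have := norm_nonneg (β - θ)
      gcongr
    have h2 : ‖α ^ (t * s)‖ ≤ B ^ (N + 1) := by
      rw [norm_zpow]
      rcases Int.natAbs_eq (t * s) with h | h
      · rw [h, zpow_natCast]
        refine (pow_le_pow_left₀ (norm_nonneg _) hαB _).trans (pow_le_pow_right₀ hB ?_)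
        have : ((t * s).natAbs : ℤ) ≤ N := (Int.natCast_natAbs (t * s)).trans_le htsN
        omega
      · rw [h, zpow_neg, zpow_natCast, ← inv_pow]
        refine (pow_le_pow_left₀ (by positivity) hαB' _).trans (pow_le_pow_right₀ hB ?_)
        have : ((t * s).natAbs : ℤ) ≤ N := (Int.natCast_natAbs (t * s)).trans_le htsN
        omega
    have h3 : ‖θ ^ k‖ ≤ R ^ S := by
      rw [norm_pow]
      exact (pow_le_pow_left₀ (norm_nonneg _) hθR _).trans (pow_le_pow_right₀ hR hk)
    have h4 : ‖α ^ (t * s) - w ^ (t * s)‖ ≤ N * B ^ (N + 1) * ‖α - w‖ :=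
      norm_zpow_sub_zpow_le_sharp hB hαB hwB hα0 hw0 hαB' hwB' htsN
    calc ‖β ^ k - θ ^ k‖ * ‖α ^ (t * s)‖ + ‖θ ^ k‖ * ‖α ^ (t * s) - w ^ (t * s)‖
        ≤ ((S : ℝ) * R ^ S * ‖β - θ‖) * B ^ (N + 1) + R ^ S * (N * B ^ (N + 1) * ‖α - w‖) :=
          add_le_add (mul_le_mul h1 h2 (norm_nonneg _) (by positivity))
            (mul_le_mul h3 h4 (norm_nonneg _) (by positivity))
      _ = Pe := by rw [hPe]; ring
  -- the difference, termwise
  rw [eval_twist_pow_delta, iteratedDeriv_f_int']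
  have hdiff : ((den τ H : ℂ))⁻¹ * (∑ k ∈ range (σ + 1),
        (σ.choose k : ℂ) * (k ! : ℂ) * (hasseZ τ H k s : ℂ) * ((t : ℂ) * β) ^ (σ - k)) * α ^ (t * s) -
      ((den τ H : ℂ))⁻¹ * (∑ k ∈ range (σ + 1),
        (σ.choose k : ℂ) * (k ! : ℂ) * (hasseZ τ H k s : ℂ) * (θ * t) ^ (σ - k)) * w ^ (t * s) =
      ((den τ H : ℂ))⁻¹ * ∑ k ∈ range (σ + 1),
        (σ.choose k : ℂ) * (k ! : ℂ) * (hasseZ τ H k s : ℂ) * (t : ℂ) ^ (σ - k) *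
          (β ^ (σ - k) * α ^ (t * s) - θ ^ (σ - k) * w ^ (t * s)) := by
    rw [Finset.mul_sum, Finset.mul_sum, Finset.sum_mul, Finset.sum_mul, ← Finset.sum_sub_distrib,
      Finset.mul_sum]
    refine Finset.sum_congr rfl fun k _ => ?_
    rw [mul_pow, mul_pow]; ring
  rw [hdiff, norm_mul, norm_inv, Complex.norm_natCast]
  refine le_trans (mul_le_mul_of_nonneg_left (norm_sum_le _ _) (by positivity)) ?_
  have hterm : ∀ k ∈ range (σ + 1),
      ‖(σ.choose k : ℂ) * (k ! : ℂ) * (hasseZ τ H k s : ℂ) * (t : ℂ) ^ (σ - k) *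
          (β ^ (σ - k) * α ^ (t * s) - θ ^ (σ - k) * w ^ (t * s))‖ ≤
        ((T₁ : ℝ) ^ σ * Pe) *
          ((σ.choose k : ℝ) * k ! * (hasseDeriv k (num ℝ τ H)).eval (|(s : ℝ)|)) := by
    intro k hk
    have hkσ : k ≤ σ := Nat.lt_succ_iff.mp (mem_range.mp hk)
    rw [norm_mul, norm_mul, norm_mul, norm_mul, norm_pow, Complex.norm_natCast, Complex.norm_natCast,
      Complex.norm_intCast]
    have h1 : |(hasseZ τ H k s : ℝ)| ≤ (hasseDeriv k (num ℝ τ H)).eval (|(s : ℝ)|) := abs_hasseZ_le τ H k s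
    have h2 : ‖(t : ℂ)‖ ^ (σ - k) ≤ (T₁ : ℝ) ^ σ :=
      (pow_le_pow_left₀ (norm_nonneg _) htr _).trans (pow_le_pow_right₀ hT₁r (Nat.sub_le _ _))
    have h3 : ‖β ^ (σ - k) * α ^ (t * s) - θ ^ (σ - k) * w ^ (t * s)‖ ≤ Pe :=
      hmono (σ - k) ((Nat.sub_le σ k).trans hσ)
    have h0 : (0 : ℝ) ≤ (σ.choose k : ℝ) * k ! := by positivity
    have hnn := hasseDeriv_num_eval_nonneg τ H k (abs_nonneg (s : ℝ))
    have hA : (σ.choose k : ℝ) * (k ! : ℝ) * |(hasseZ τ H k s : ℝ)| ≤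
        (σ.choose k : ℝ) * (k ! : ℝ) * (hasseDeriv k (num ℝ τ H)).eval (|(s : ℝ)|) :=
      mul_le_mul_of_nonneg_left h1 h0
    have hB' : (σ.choose k : ℝ) * (k ! : ℝ) * |(hasseZ τ H k s : ℝ)| * ‖(t : ℂ)‖ ^ (σ - k) ≤
        (σ.choose k : ℝ) * (k ! : ℝ) * (hasseDeriv k (num ℝ τ H)).eval (|(s : ℝ)|) * (T₁ : ℝ) ^ σ :=
      mul_le_mul hA h2 (by positivity) (mul_nonneg h0 hnn)
    calc (σ.choose k : ℝ) * (k ! : ℝ) * |(hasseZ τ H k s : ℝ)| * ‖(t : ℂ)‖ ^ (σ - k) *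
          ‖β ^ (σ - k) * α ^ (t * s) - θ ^ (σ - k) * w ^ (t * s)‖
        ≤ (σ.choose k : ℝ) * (k ! : ℝ) * (hasseDeriv k (num ℝ τ H)).eval (|(s : ℝ)|) * (T₁ : ℝ) ^ σ * Pe :=
          mul_le_mul hB' h3 (norm_nonneg _) (mul_nonneg (mul_nonneg h0 hnn) (by positivity))
      _ = _ := by ring
  refine le_trans (mul_le_mul_of_nonneg_left (Finset.sum_le_sum hterm) (by positivity)) ?_
  rw [← Finset.mul_sum]
  have h43 := sum_choose_mul_factorial_mul_hasse_le τ σ hH (abs_nonneg (s : ℝ))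
  have hbase : 1 + |(s : ℝ)| / H ≤ 1 + (S₁ : ℝ) / H := by gcongr
  have hbase1 : (1 : ℝ) ≤ 1 + (S₁ : ℝ) / H := by
    have : (0 : ℝ) ≤ (S₁ : ℝ) / H := by positivity
    linarith
  have hpowτ : (1 + |(s : ℝ)| / H) ^ τ ≤ (1 + (S₁ : ℝ) / H) ^ T :=
    (pow_le_pow_left₀ (by positivity) hbase τ).trans (pow_le_pow_right₀ hbase1 hτ)
  have hexpτ : Real.exp ((τ : ℝ) + H) ≤ Real.exp ((T : ℝ) + H) := by
    rw [Real.exp_le_exp]; gcongr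
  have hσS := pow_self_le_pow_self hσ
  have hT₁σ : (T₁ : ℝ) ^ σ ≤ (T₁ : ℝ) ^ S := pow_le_pow_right₀ hT₁r hσ
  calc ((den τ H : ℝ))⁻¹ * (((T₁ : ℝ) ^ σ * Pe) *
        ∑ k ∈ range (σ + 1), (σ.choose k : ℝ) * k ! * (hasseDeriv k (num ℝ τ H)).eval (|(s : ℝ)|))
      ≤ ((den τ H : ℝ))⁻¹ * (((T₁ : ℝ) ^ σ * Pe) *
        ((σ : ℝ) ^ σ * Real.exp ((τ : ℝ) + H) * (1 + |(s : ℝ)| / H) ^ τ * den τ H)) := by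
        refine mul_le_mul_of_nonneg_left (mul_le_mul_of_nonneg_left h43 (by positivity)) (by positivity)
    _ = (σ : ℝ) ^ σ * Real.exp ((τ : ℝ) + H) * (1 + |(s : ℝ)| / H) ^ τ * (T₁ : ℝ) ^ σ * Pe := by
        field_simp
    _ ≤ (S : ℝ) ^ S * Real.exp ((T : ℝ) + H) * (1 + (S₁ : ℝ) / H) ^ T * (T₁ : ℝ) ^ S * Pe := by gcongr
    _ = _ := by rw [hPe]

/-- **The scaled algebraic entry is an integer polynomial in `β`** (general `α`): for `σ ≤ S`,
`H ≥ 1`, `ν(H)^σ · ((∂ + tβ)^σ Δ_τ)(s) = ∑_{k ≤ S} p(σ,τ,s,t,k) β^{σ-k}` with the integers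
`p = NWPi.pZ` of Lemma 4 (`NWPi.scaled_entry_eq` without the factor `(-1)^{ts}`).
[cite: NesterenkoWaldschmidt1996, §6 c)] -/
theorem scaled_entry_eq' {β : ℂ} {H σ S : ℕ} (τ : ℕ) (hH : 1 ≤ H) (hσ : σ ≤ S) (s t : ℤ) :
    (Nat.lcmUpto H : ℂ) ^ σ * ((twist ((t : ℂ) * β) ^ σ) (delta τ H)).eval (s : ℂ) =
      ∑ k ∈ range (S + 1), (pZ H σ τ s t k : ℂ) * β ^ (σ - k) := by
  rw [eval_twist_pow_delta]
  have hrestr : ∑ k ∈ range (S + 1), (pZ H σ τ s t k : ℂ) * β ^ (σ - k) =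
      ∑ k ∈ range (σ + 1), (pZ H σ τ s t k : ℂ) * β ^ (σ - k) := by
    symm
    refine Finset.sum_subset (Finset.range_subset_range.mpr (by omega)) fun k _ hkσ => ?_
    have hk : σ < k := by simp only [Finset.mem_range, not_lt] at hkσ; omega
    rw [pZ_of_lt hk, Int.cast_zero, zero_mul]
  rw [hrestr, ← mul_assoc, Finset.mul_sum]
  refine Finset.sum_congr rfl fun k hk => ?_
  have hkσ : k ≤ σ := Nat.lt_succ_iff.mp (mem_range.mp hk)
  rw [cast_pZ τ hH hkσ s t, mul_pow]
  ring

end Entries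

end Summit.Schanuel.Schanuel.Theorems.RootDecomp1KNW96Core

end
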